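import Literature.AlgebraicGeometry.Tropical.WeilFamily

/-!
# Sketch — crux idea `cm-point-seeds` for `TropicalWeilSupply` (stmt-HodgeConjecture-18676)

First checkable statement of the idea: at the CM member `Q₀ = diag(δ·1ₙ, 1ₙ)` of the tropical Weil
family `𝓛_δ⁺` there is an EFFECTIVE tropical `n`-cycle (a union of flat rational product subtori)
with non-zero `ℚ(√-δ)`-Weil functional whose class is Hodge along the WHOLE family (universally
Hodge), i.e. the class-level necessary condition for a linearly spreading seed is satisfiable for
every `n ≥ 2`, `δ ≥ 1`.  (`n = m + 1` below to keep `Fin` arithmetic definitional.)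
-/

noncomputable section

open scoped BigOperators
open Literature.AlgebraicGeometry.Tropical

namespace Summit.HodgeConjecture.HodgeConjecture.Cruxes.TropicalWeilSupply.CMPointSeeds

/-- The CM member `Q₀ = diag(δ, …, δ, 1, …, 1)` of `𝓛_δ⁺`: `B_{Q₀} = E₁ × ⋯ × E_n`,
`E_k = ℝ⟨e_k, e_{k+n}⟩ / (δℤ ⊕ ℤ)` the `n = 1` CM torus. -/
def cmQ (n δ : ℕ) : Matrix (Fin (2 * n)) (Fin (2 * n)) ℝ :=
  Matrix.diagonal fun a => if (a : ℕ) < n then (δ : ℝ) else 1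

/-- Mikhalkin–Zharkov eigenwave condition in Plücker coordinates: a `(p,p)`-tensor
`T ∈ ⋀ᵖV ⊗ ⋀ᵖV` (`p = m + 1`, both slots alternating functions of row selections, as for
`TropicalTorusCycle.cyc`) is a tropical HODGE class iff its contraction
`φ(T) ∈ ⋀ᵖ⁻¹V ⊗ ⋀ᵖ⁺¹V` vanishes: `Σ_s (-1)^s · T(A, c_s ; C ∖ c_s) = 0` for all `A`, `C`. -/
def HodgeAt (g m : ℕ) (T : (Fin (m + 1) → Fin g) → (Fin (m + 1) → Fin g) → ℝ) : Prop :=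
  ∀ (A : Fin m → Fin g) (C : Fin (m + 2) → Fin g),
    (∑ s : Fin (m + 2), (-1 : ℝ) ^ (s : ℕ) * T (Fin.snoc A (C s)) (fun i => C (s.succAbove i))) = 0

/-- Transport of a class given in `V ⊗ V`-coordinates at one member to another member with the
SAME integral coordinates in `⋀ᵖΓ₁ ⊗ ⋀ᵖΓ₂`: apply `⋀ᵖR ⊗ 1`, `R = Q · Q₀⁻¹` (the sum over all
`K` overcounts by the constant `p!`, irrelevant for vanishing conditions). -/
def transport (g m : ℕ) (R : Matrix (Fin g) (Fin g) ℝ)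
    (T : (Fin (m + 1) → Fin g) → (Fin (m + 1) → Fin g) → ℝ) :
    (Fin (m + 1) → Fin g) → (Fin (m + 1) → Fin g) → ℝ :=
  fun S S' => ∑ K : Fin (m + 1) → Fin g, (Matrix.of fun i j => R (S i) (K j)).det * T K S'

/-- A class `T` at `Q₀` (in `V ⊗ V` coordinates) is UNIVERSALLY HODGE along `𝓛_δ⁺`: its transport
to every member of the family is a Hodge class there.  (Necessary for `T` to be the class of a
combinatorial type of tropical cycle realised over an open set of the family.) -/
def UniversallyHodge (m δ : ℕ) (Q₀ : Matrix (Fin (2 * (m + 1))) (Fin (2 * (m + 1))) ℝ)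
    (T : (Fin (m + 1) → Fin (2 * (m + 1))) → (Fin (m + 1) → Fin (2 * (m + 1))) → ℝ) : Prop :=
  ∀ P : WeilFamily.Polarization (m + 1) δ,
    HodgeAt (2 * (m + 1)) m (transport (2 * (m + 1)) m (P.Q * Q₀⁻¹) T)

/-- FIRST LEMMA (idea `cm-point-seeds`): for every `n = m + 1 ≥ 2` and `δ ≥ 1` the CM member
carries an effective tropical `n`-cycle with non-zero Weil functional and universally Hodge class
(on paper: `N·θⁿ + w`, `w` rational in the universally-Hodge space with non-zero Weil component,
realised by flat rational product subtori via the interior of the fully separable cone). -/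
def CMSeed : Prop :=
  ∀ m : ℕ, 1 ≤ m → ∀ δ : ℕ, 1 ≤ δ →
    ∃ Z : TropicalTorusCycle (2 * (m + 1)) (m + 1) (cmQ (m + 1) δ),
      WeilFamily.functional δ Z ≠ 0 ∧ UniversallyHodge m δ (cmQ (m + 1) δ) Z.cyc

/-- The CM matrix is a member of the family (so `CMSeed` instantiates the `∃ P₀` of the line's
`SeedSupply` at `P₀.Q = cmQ n δ`). -/
def CMIsMember : Prop :=
  ∀ n δ : ℕ, 1 ≤ δ → ∃ P : WeilFamily.Polarization n δ, P.Q = cmQ n δ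

end Summit.HodgeConjecture.HodgeConjecture.Cruxes.TropicalWeilSupply.CMPointSeeds

end
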